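import Mathlib
import Summits.MatrixMultiplication.Statement
import Summits.MatrixMultiplication.MatrixMultiplication.Theorems.GraphEquationsTowerStages
import Summits.MatrixMultiplication.MatrixMultiplication.Theorems.GraphEquationsJetAlgebra
import Summits.MatrixMultiplication.MatrixMultiplication.Theorems.GraphEquationsAffineJets
import Summits.MatrixMultiplication.MatrixMultiplication.Theorems.GraphEquationsIsolationLocus

/-!
# Graph equations — specialisation of the identity tower: cleared identities (M25a)

We run the identity tower (`exists_towerStages`) over the function field `K = ℂ(a,b)`
(`FractionRing ℂ[a,b]`), index its outputs by the finite type
`O = (Fin T × Fin |W|) ⊕ Fin |ex|` (`towerOut`), and clear denominators (NODE-g36 §3, file E2):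

`exists_towerCleared` — numerators `N : κ → ℂ[a,b]` and ONE common denominator `d ≠ 0` for the
point `lam = N/d` and for the coefficients `c = Cn/d` expressing each fibre standard vector `e_y` as a
`K`-combination of the fibre gradients, together with the POLYNOMIAL identities
* `clearEval (secPoly (out o)) N d M = 0` for every output (all outputs vanish at `N/d`),
* `∑_o Cn y o · clearEval (secPoly (∂_{y'} out o)) N d M = [y = y'] · d^{M+1}` (duality),
and a point `p ∈ ℂ^{MatMulVars n}` with `d(p) ≠ 0`.  These identities transport to the `ℂ`-point
`p` (`eval p`) and to its 2-jet ring (`mk ∘ shift`) by `GraphEquationsJetAlgebra`.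
-/

set_option linter.dupNamespace false

noncomputable section

open scoped BigOperators nonZeroDivisors

namespace Summit.MatrixMultiplication.MatrixMultiplication.Theorems.GraphEquations

open MvPolynomial
open Literature.Computability.AlgebraicComplexity

variable {n : ℕ}

section Out

variable {κ : Type}

/-- The outputs of a tower, indexed by (base generator, word) pairs and extras. -/
def towerOut {T : ℕ} (t : Fin T → MvPolynomial (GraphVars n) ℂ)
    (W : List (List (Derivation ℂ (MvPolynomial (GraphVars n ⊕ κ) ℂ)
      (MvPolynomial (GraphVars n ⊕ κ) ℂ))))
    (ex : List (MvPolynomial (GraphVars n ⊕ κ) ℂ)) :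
    (Fin T × Fin W.length) ⊕ Fin ex.length → MvPolynomial (GraphVars n ⊕ κ) ℂ :=
  Sum.elim (fun ow => (W.get ow.2).foldl (fun acc D => D acc) (rename Sum.inl (t ow.1)))
    fun x => ex.get x

/-- The output set of `exists_towerStages` is the range of `towerOut`. -/
theorem towerOut_range_eq {T : ℕ} (t : Fin T → MvPolynomial (GraphVars n) ℂ)
    (W : List (List (Derivation ℂ (MvPolynomial (GraphVars n ⊕ κ) ℂ)
      (MvPolynomial (GraphVars n ⊕ κ) ℂ))))
    (ex : List (MvPolynomial (GraphVars n ⊕ κ) ℂ)) :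
    ({g | ∃ o, ∃ w ∈ W, g = w.foldl (fun acc D => D acc) (rename Sum.inl (t o))} ∪ {e | e ∈ ex}) =
      Set.range (towerOut t W ex) := by
  ext g
  constructor
  · rintro (⟨o, w, hw, rfl⟩ | he)
    · obtain ⟨i, rfl⟩ := List.mem_iff_get.mp hw
      exact ⟨Sum.inl (o, i), rfl⟩
    · obtain ⟨i, rfl⟩ := List.mem_iff_get.mp he
      exact ⟨Sum.inr i, rfl⟩
  · rintro ⟨(⟨o, i⟩ | i), rfl⟩
    · exact Or.inl ⟨o, W.get i, List.get_mem _ _, rfl⟩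
    · exact Or.inr (List.get_mem _ _)

/-- The fibre coordinate map `y ↦` variable (`c_q` or `λ_i`). -/
def fibreVar (n : ℕ) (κ : Type) : (Fin n × Fin n) ⊕ κ → GraphVars n ⊕ κ :=
  Sum.elim (fun q => Sum.inl (Sum.inr q)) Sum.inr

omit [κ : Type] in
/-- `towerRow` through `fibreVar`. -/
theorem towerRow_eq_aeval_pderiv {K : Type*} [Field K] [Algebra ℂ K]
    [Algebra (MvPolynomial (MatMulVars n) ℂ) K] {κ : Type} (lam : κ → K)
    (g : MvPolynomial (GraphVars n ⊕ κ) ℂ) (y : (Fin n × Fin n) ⊕ κ) :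
    towerRow lam g y = aeval (towerPt lam) (pderiv (fibreVar n κ y) g) := rfl

end Out

section Cleared

/-- Degree bound from the total degree. -/
theorem degree_le_of_totalDegree_le {σ : Type*} {A : Type*} [CommRing A] {F : MvPolynomial σ A}
    {M : ℕ} (hM : F.totalDegree ≤ M) : ∀ mono ∈ F.support, mono.degree ≤ M := fun _ hmono =>
  (le_totalDegree hmono).trans hM

set_option maxHeartbeats 800000 in
/-- **Cleared identities of a tower over `ℂ(a,b)`** (any kernel index type `κ`): given outputs
(words `W` applied to the base generators, extras `ex`) vanishing at `towerPt lam` whose fibre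
gradients span, there are numerators `N`, ONE common denominator `d`, a degree bound `M`, duality
numerators `Cn` and a point `p` with `d(p) ≠ 0` satisfying the polynomial identities of the module
docstring. -/
theorem towerCleared_of_stages {K : Type*} [Field K] [Algebra ℂ K]
    [Algebra (MvPolynomial (MatMulVars n) ℂ) K] [IsScalarTower ℂ (MvPolynomial (MatMulVars n) ℂ) K]
    [IsFractionRing (MvPolynomial (MatMulVars n) ℂ) K]
    {κ : Type} [Fintype κ] [DecidableEq κ] {T : ℕ}
    (t : Fin T → MvPolynomial (GraphVars n) ℂ)
    (W : List (List (Derivation ℂ (MvPolynomial (GraphVars n ⊕ κ) ℂ)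
      (MvPolynomial (GraphVars n ⊕ κ) ℂ))))
    (ex : List (MvPolynomial (GraphVars n ⊕ κ) ℂ))
    (lam : κ → K)
    (hvanW : ∀ o, ∀ w ∈ W, aeval (towerPt lam) (w.foldl (fun acc D => D acc) (rename Sum.inl (t o))) = 0)
    (hvanE : ∀ e ∈ ex, aeval (towerPt lam) e = 0)
    (hspan : Submodule.span K (towerRow lam ''
      ({g | ∃ o, ∃ w ∈ W, g = w.foldl (fun acc D => D acc) (rename Sum.inl (t o))} ∪ {e | e ∈ ex})) = ⊤) :
    ∃ (N : κ → MvPolynomial (MatMulVars n) ℂ) (d : MvPolynomial (MatMulVars n) ℂ) (M : ℕ)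
      (Cn : (Fin n × Fin n) ⊕ κ → (Fin T × Fin W.length) ⊕ Fin ex.length →
        MvPolynomial (MatMulVars n) ℂ)
      (p : MatMulVars n → ℂ),
      eval p d ≠ 0 ∧
      (∀ o, (∀ mono ∈ (secPoly (towerOut t W ex o)).support, mono.degree ≤ M) ∧
        clearEval (secPoly (towerOut t W ex o)) N d M = 0) ∧
      (∀ o y, ∀ mono ∈ (secPoly (pderiv (fibreVar n κ y) (towerOut t W ex o))).support,
        mono.degree ≤ M) ∧
      (∀ y y', ∑ o, Cn y o * clearEval (secPoly (pderiv (fibreVar n κ y') (towerOut t W ex o))) N d M =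
        if y = y' then d ^ (M + 1) else 0) := by
  classical
  set out := towerOut t W ex with hout
  -- every output vanishes at the point
  have hvan : ∀ o, aeval (towerPt lam) (out o) = 0 := by
    rintro (⟨o, i⟩ | i)
    · exact hvanW o _ (List.get_mem _ _)
    · exact hvanE _ (List.get_mem _ _)
  -- the rows of the outputs span everything
  have hspan' : ∀ y : (Fin n × Fin n) ⊕ κ, (Pi.single y 1 : _ → K) ∈
      Submodule.span K (Set.range fun o => towerRow lam (out o)) := by
    intro y
    have htop : (Pi.single y 1 : _ → K) ∈ (⊤ : Submodule K _) := Submodule.mem_top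
    rw [← hspan, towerOut_range_eq, ← Set.range_comp] at htop
    exact htop
  have hc : ∀ y : (Fin n × Fin n) ⊕ κ, ∃ c : (Fin T × Fin W.length) ⊕ Fin ex.length → K,
      ∑ o, c o • towerRow lam (out o) = Pi.single y 1 := fun y =>
    (Submodule.mem_span_range_iff_exists_fun K).mp (hspan' y)
  choose c hc using hc
  -- one common denominator for `lam` and `c`
  obtain ⟨b, hb⟩ := IsLocalization.exist_integer_multiples_of_finite
    (nonZeroDivisors (MvPolynomial (MatMulVars n) ℂ))
    (Sum.elim lam (fun yo : ((Fin n × Fin n) ⊕ κ) × ((Fin T × Fin W.length) ⊕ Fin ex.length) =>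
      c yo.1 yo.2) : _ → K)
  have hb' : ∀ i, ∃ a : MvPolynomial (MatMulVars n) ℂ, algebraMap _ K a =
      (b : MvPolynomial (MatMulVars n) ℂ) • Sum.elim lam (fun yo : ((Fin n × Fin n) ⊕ κ) ×
        ((Fin T × Fin W.length) ⊕ Fin ex.length) => c yo.1 yo.2) i := fun i => by
    obtain ⟨a, ha⟩ := hb i; exact ⟨a, ha⟩
  choose Nf hNf using hb'
  set d : MvPolynomial (MatMulVars n) ℂ := (b : MvPolynomial (MatMulVars n) ℂ) with hd
  have hdK : algebraMap _ K d ≠ 0 := IsFractionRing.to_map_ne_zero_of_mem_nonZeroDivisors b.2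
  have hd0 : d ≠ 0 := nonZeroDivisors.coe_ne_zero b
  set N : κ → MvPolynomial (MatMulVars n) ℂ := fun x => Nf (Sum.inl x) with hN
  set Cn : (Fin n × Fin n) ⊕ κ → (Fin T × Fin W.length) ⊕ Fin ex.length →
      MvPolynomial (MatMulVars n) ℂ := fun y o => Nf (Sum.inr (y, o)) with hCn
  have hlam : lam = fun x => algebraMap _ K (N x) * (algebraMap _ K d)⁻¹ := by
    funext x
    have h := hNf (Sum.inl x)
    rw [Sum.elim_inl, Algebra.smul_def] at h
    rw [hN]; dsimp only
    rw [h, mul_comm, ← mul_assoc, inv_mul_cancel₀ hdK, one_mul]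
  have hcK : ∀ y o, c y o = algebraMap _ K (Cn y o) * (algebraMap _ K d)⁻¹ := by
    intro y o
    have h := hNf (Sum.inr (y, o))
    rw [Sum.elim_inr, Algebra.smul_def] at h
    rw [hCn]; dsimp only
    rw [h, mul_comm, ← mul_assoc, inv_mul_cancel₀ hdK, one_mul]
  -- the common degree bound
  set M : ℕ := (Finset.univ.sup fun o => (secPoly (out o)).totalDegree) ⊔
    Finset.univ.sup fun oy : ((Fin T × Fin W.length) ⊕ Fin ex.length) × ((Fin n × Fin n) ⊕ κ) =>
      (secPoly (pderiv (fibreVar n κ oy.2) (out oy.1))).totalDegree with hM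
  have hM1 : ∀ o, ∀ mono ∈ (secPoly (out o)).support, mono.degree ≤ M := fun o =>
    degree_le_of_totalDegree_le ((Finset.le_sup (f := fun o => (secPoly (out o)).totalDegree)
      (Finset.mem_univ o)).trans le_sup_left)
  have hM2 : ∀ o y, ∀ mono ∈ (secPoly (pderiv (fibreVar n κ y) (out o))).support,
      mono.degree ≤ M := fun o y =>
    degree_le_of_totalDegree_le ((Finset.le_sup
      (f := fun oy : ((Fin T × Fin W.length) ⊕ Fin ex.length) × ((Fin n × Fin n) ⊕ κ) =>
        (secPoly (pderiv (fibreVar n κ oy.2) (out oy.1))).totalDegree)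
      (Finset.mem_univ (o, y))).trans le_sup_right)
  -- a point off the denominator
  obtain ⟨p, hp⟩ := exists_eval_ne_zero hd0
  refine ⟨N, d, M, Cn, p, hp, fun o => ⟨hM1 o, ?_⟩, hM2, ?_⟩
  · -- outputs
    refine clearEval_eq_zero_of_eval₂_eq_zero (K := K) hdK (hM1 o) ?_
    rw [← hlam, ← aeval_towerPt_eq_eval₂_secPoly]
    exact hvan o
  · -- duality
    intro y y'
    apply IsFractionRing.injective (MvPolynomial (MatMulVars n) ℂ) K
    have hrow : ∀ o, algebraMap _ K (clearEval (secPoly (pderiv (fibreVar n κ y') (out o))) N d M) =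
        algebraMap _ K d ^ M * towerRow lam (out o) y' := by
      intro o
      rw [map_clearEval (algebraMap _ K) _ N d (hM2 o y') _ (mul_inv_cancel₀ hdK),
        towerRow_eq_aeval_pderiv, aeval_towerPt_eq_eval₂_secPoly, hlam]
    have hcy := congr_fun (hc y) y'
    rw [Finset.sum_apply] at hcy
    simp only [Pi.smul_apply, smul_eq_mul] at hcy
    rw [map_sum]
    have hterm : ∀ o, algebraMap _ K (Cn y o *
        clearEval (secPoly (pderiv (fibreVar n κ y') (out o))) N d M) =
        algebraMap _ K d ^ (M + 1) * (c y o * towerRow lam (out o) y') := by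
      intro o
      rw [map_mul, hrow, hcK y o, pow_succ]
      rw [show algebraMap _ K d ^ M * algebraMap _ K d *
          (algebraMap _ K (Cn y o) * (algebraMap _ K d)⁻¹ * towerRow lam (out o) y') =
          algebraMap _ K d ^ M * (algebraMap _ K d * (algebraMap _ K d)⁻¹) *
            (algebraMap _ K (Cn y o) * towerRow lam (out o) y') by ring, mul_inv_cancel₀ hdK]
      ring
    rw [Finset.sum_congr rfl fun o _ => hterm o, ← Finset.mul_sum, hcy]
    split_ifs with h
    · subst h
      rw [Pi.single_eq_same, mul_one, map_pow]
    · rw [map_zero, mul_eq_zero]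
      exact Or.inr (Pi.single_eq_of_ne (Ne.symm h) _)


/-- **Cleared identities of the identity tower** (`exists_towerStages` over `ℂ(a,b)`, then
`towerCleared_of_stages`). -/
theorem exists_towerCleared {T : ℕ} (t : Fin T → MvPolynomial (GraphVars n) ℂ)
    (ht : ∀ o, t o ∈ graphIdeal n) {m : ℕ} (hm : 1 ≤ m)
    (hgen : ∀ q, generator n q ^ m ∈ Ideal.span (Set.range t)) :
    ∃ (κ : Type) (_ : Fintype κ) (_ : DecidableEq κ)
      (Ds : List (Derivation ℂ (MvPolynomial (GraphVars n ⊕ κ) ℂ) (MvPolynomial (GraphVars n ⊕ κ) ℂ)))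
      (W : List (List (Derivation ℂ (MvPolynomial (GraphVars n ⊕ κ) ℂ)
        (MvPolynomial (GraphVars n ⊕ κ) ℂ))))
      (ex : List (MvPolynomial (GraphVars n ⊕ κ) ℂ))
      (N : κ → MvPolynomial (MatMulVars n) ℂ) (d : MvPolynomial (MatMulVars n) ℂ) (M : ℕ)
      (Cn : (Fin n × Fin n) ⊕ κ → (Fin T × Fin W.length) ⊕ Fin ex.length →
        MvPolynomial (MatMulVars n) ℂ)
      (p : MatMulVars n → ℂ),
      Ds.length + 1 = m ∧ (∀ w ∈ W, w.Sublist Ds) ∧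
      (∀ D ∈ Ds, (∀ v, D (X v) ∈ freeSpan ∅) ∧ ∀ v : MatMulVars n, D (X (Sum.inl (Sum.inl v))) = 0) ∧
      (∀ e ∈ ex, e ∈ freeSpan ∅) ∧
      eval p d ≠ 0 ∧
      (∀ o, (∀ mono ∈ (secPoly (towerOut t W ex o)).support, mono.degree ≤ M) ∧
        clearEval (secPoly (towerOut t W ex o)) N d M = 0) ∧
      (∀ o y, ∀ mono ∈ (secPoly (pderiv (fibreVar n κ y) (towerOut t W ex o))).support,
        mono.degree ≤ M) ∧
      (∀ y y', ∑ o, Cn y o * clearEval (secPoly (pderiv (fibreVar n κ y') (towerOut t W ex o))) N d M =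
        if y = y' then d ^ (M + 1) else 0) := by
  obtain ⟨κ, _, _, Ds, W, ex, lam, hlen, hsub, hDs, hex, hvanW, hvanE, hspan⟩ :=
    exists_towerStages (K := FractionRing (MvPolynomial (MatMulVars n) ℂ)) t ht hm hgen
  obtain ⟨N, d, M, Cn, p, h⟩ := towerCleared_of_stages t W ex lam hvanW hvanE hspan
  exact ⟨κ, inferInstance, inferInstance, Ds, W, ex, N, d, M, Cn, p, hlen, hsub, hDs, hex, h⟩

end Cleared

end Summit.MatrixMultiplication.MatrixMultiplication.Theorems.GraphEquations

end
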